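import Literature.NumberTheory.GelbartRogawski1991.Prop311PrintedLegOfFrame
import Literature.NumberTheory.Weil1964.AdelicMetaplecticUnitaryLegL2
import Literature.NumberTheory.Weil1964.AdelicSchrodingerL2Dense
import HarnessLib

/-!
# [GelbartRogawski1991, §3.1 p. 454 L19–21]: the `L²(𝐀_Fⁿ)` model of the printed `ρ_ψ` READ THROUGH A DARBOUX FRAME

Topic `NumberTheory/GelbartRogawski1991`; namespace `Literature.NumberTheory.GelbartRogawski1991.Prop311`.  KERNEL ONLY:
theorems; no definition, no named fact, no `sorry`; `Prop311AsPrinted` is untouched.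

`Prop311RhoPsiL2.rho_exists_L2` inhabits the binders "`ρ_ψ` an irreducible unitary representation of `H_𝐀(W)` with central
character `ψ`" of `Prop311AsPrinted` by an EXISTENTIAL package (some frame, some Haar measure, some surjection `p`).  The
junction files of the printed side (`Prop311PrintedLegOfFrame.legOfFrame`, `prop311_CM_of_boundedLeg`, and the
along-the-section socket `Prop311PrintedDarbouxLegAlong`) instead take a model in the EXPOSED shape
`ρ h f = ρ₁ (toCoordHeisenberg e he h) f` for a GIVEN adelic Darboux frame `e : 𝐀ⁿ × 𝐀ⁿ ≃ W_𝐀` and a representation `ρ₁`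
of Weil's polarised group `H(𝐀ⁿ × 𝐀ⁿ, std) = Weil1964.AdelicHeisenberg F (Fin n) 1`.  This file supplies exactly that: for
EVERY frame `(e, he)`, EVERY continuous character `ψ` and EVERY additive Haar measure `ν` on `𝐀_Fⁿ`, the representation

  `(SchrodingerHaar.rep (adelicForm F (Fin n) 1) ψ _ _ ν).comp (toCoordHeisenberg e he)`

of `H_𝐀(W)` on `L²(𝐀_Fⁿ, ν)` is by linear ISOMETRIES (`norm_rep_comp_toCoordHeisenberg`), has CONTINUOUS orbit maps for
`heisenbergTopology` (`continuous_rep_comp_toCoordHeisenberg`), has NO closed invariant subspace other than `⊥`, `⊤` as soon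
as `ψ` is a non-trivial character of `𝐀/F` (`irreducible_rep_comp_toCoordHeisenberg`, from
`Weil1964.adelicSchrodingerL2_irreducible_one` through the surjection `toCoordHeisenberg e he`), and has CENTRAL CHARACTER `ψ`
(`rep_comp_toCoordHeisenberg_ofCenter`); the relation `hρ` of `legOfFrame` holds by `rfl` (`rep_comp_toCoordHeisenberg_apply`).
For the character of record `ψ_F = adeleAddChar F` (the one of Weil's smooth model `adelicSchrodinger` and of the unitary leg
`adelicMpCont.unitaryLegL2`) everything is packaged with the two inputs of that leg — `[·] : 𝒮(𝐀_Fⁿ) → L²` has dense range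
(`denseRange_schwartzBruhatToL2`, from `Weil1964.dense_piSchwartzBruhat`) — and `L²(𝐀_Fⁿ, ν)` is non-trivial
(`rhoL2Frame_printed_binders`).

## References
* [GelbartRogawski1991] S. Gelbart, J. Rogawski, Invent. Math. 105 (1991) 445–472, §3.1 p. 454 L17–24, Prop. 3.1.1
  p. 455 L1–2.
* [Weil1964] A. Weil, Acta Math. 111 (1964) 143–211, Chap. I n° 4 p. 149, n° 11–13, Chap. III n° 37.
* [MoeglinVignerasWaldspurger1987] C. Mœglin, M.-F. Vignéras, J.-L. Waldspurger, LNM 1291 (1987), Chap. 2 I.1–I.4.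
-/

set_option autoImplicit false

noncomputable section

open MeasureTheory NumberField
open scoped ENNReal Matrix
open Literature.RepresentationTheory.HeisenbergGroup Literature.NumberTheory.Automorphic Literature.NumberTheory.Weil1964

namespace Literature.NumberTheory.GelbartRogawski1991

namespace Prop311

attribute [local instance] secondCountableTopology_adeleRing locallyCompactSpace_adeleRing'

variable {F : Type} [Field F] [NumberField F]
variable {E : Type} [Field E] [Algebra F E]
variable {V : Type} [AddCommGroup V] [Module F V]
variable {Φ : V →ₗ[F] V →ₗ[F] E}
variable {n : ℕ}
  (e : ((Fin n → AdeleRing (𝓞 F) F) × (Fin n → AdeleRing (𝓞 F) F)) ≃ₗ[AdeleRing (𝓞 F) F] AdelicSpace F V)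
  (he : ∀ c c' : (Fin n → AdeleRing (𝓞 F) F) × (Fin n → AdeleRing (𝓞 F) F),
    adelicTraceForm F E V Φ (e c) (e c') = c.1 ⬝ᵥ c'.2 - c'.1 ⬝ᵥ c.2)
  (ψ : AddChar (AdeleRing (𝓞 F) F) Circle) (hψc : Continuous ψ)
  (hβc : ∀ y : Fin n → AdeleRing (𝓞 F) F, Continuous fun u : Fin n → AdeleRing (𝓞 F) F =>
    adelicForm F (Fin n) (1 : Matrix (Fin n) (Fin n) (AdeleRing (𝓞 F) F)) u y)
variable [MeasurableSpace (AdeleRing (𝓞 F) F)] [BorelSpace (AdeleRing (𝓞 F) F)]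
  (ν : Measure (Fin n → AdeleRing (𝓞 F) F)) [ν.IsAddHaarMeasure]

/-! ## §1 The frame model and its four printed properties -/

/-- **the relation `hρ` of `legOfFrame`** for the frame model: `ρ h f = ρ₁ (toCoordHeisenberg e he h) f`, by `rfl`.
[cite: GelbartRogawski1991, §3.1 p. 454 L17–22] -/
theorem rep_comp_toCoordHeisenberg_apply (h : AdelicHeisenberg F E V Φ) (f : Lp ℂ 2 ν) :
    ((SchrodingerHaar.rep (adelicForm F (Fin n) (1 : Matrix (Fin n) (Fin n) (AdeleRing (𝓞 F) F))) ψ hψc hβc ν).comp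
        (toCoordHeisenberg e he)) h f =
      SchrodingerHaar.rep (adelicForm F (Fin n) (1 : Matrix (Fin n) (Fin n) (AdeleRing (𝓞 F) F))) ψ hψc hβc ν
        (toCoordHeisenberg e he h) f :=
  rfl

/-- **unitarity**: the frame model acts by linear isometries of `L²(𝐀_Fⁿ, ν)` (binder `_hρu` of `Prop311AsPrinted`).
[cite: GelbartRogawski1991, §3.1 p. 454 L19–21] -/
theorem norm_rep_comp_toCoordHeisenberg (h : AdelicHeisenberg F E V Φ) (f : Lp ℂ 2 ν) :
    ‖((SchrodingerHaar.rep (adelicForm F (Fin n) (1 : Matrix (Fin n) (Fin n) (AdeleRing (𝓞 F) F))) ψ hψc hβc ν).comp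
        (toCoordHeisenberg e he)) h f‖ = ‖f‖ :=
  SchrodingerHaar.norm_rep_apply _ ψ hψc hβc ν _ f

/-- **central character `ψ`**: the centre `(0, t)` of `H_𝐀(W)` acts by `ψ(t)` in the frame model (binder `_hρz` of
`Prop311AsPrinted`; `toCoordHeisenberg` is the identity on the centre). [cite: GelbartRogawski1991, §3.1 p. 454 L20–21] -/
theorem rep_comp_toCoordHeisenberg_ofCenter (t : AdeleRing (𝓞 F) F) (f : Lp ℂ 2 ν) :
    ((SchrodingerHaar.rep (adelicForm F (Fin n) (1 : Matrix (Fin n) (Fin n) (AdeleRing (𝓞 F) F))) ψ hψc hβc ν).comp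
        (toCoordHeisenberg e he)) (Heisenberg.ofCenter (heisForm F E V Φ) (Multiplicative.ofAdd t)) f =
      ((ψ t : Circle) : ℂ) • f := by
  rw [MonoidHom.coe_comp, Function.comp_apply, toCoordHeisenberg_ofCenter, SchrodingerHaar.rep_ofCenter]

/-- **strong continuity**: every orbit map `h ↦ ρ h f` of the frame model is continuous for the printed topology
`heisenbergTopology` of `H_𝐀(W) = W_𝐀 × 𝐀` (binder `_hρc` of `Prop311AsPrinted`): the frame `e⁻¹` is continuous for the
module topology of `W_𝐀`, and `SchrodingerHaar.rep` is strongly continuous on `(𝐀ⁿ × 𝐀ⁿ) × 𝐀`.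
[cite: GelbartRogawski1991, §3.1 p. 454 L19–21] -/
theorem continuous_rep_comp_toCoordHeisenberg (f : Lp ℂ 2 ν) :
    @Continuous _ _ (heisenbergTopology F E V Φ) _ fun h : AdelicHeisenberg F E V Φ =>
      ((SchrodingerHaar.rep (adelicForm F (Fin n) (1 : Matrix (Fin n) (Fin n) (AdeleRing (𝓞 F) F))) ψ hψc hβc ν).comp
        (toCoordHeisenberg e he)) h f := by
  haveI : BorelSpace (Fin n → AdeleRing (𝓞 F) F) := Pi.borelSpace
  set β : (Fin n → AdeleRing (𝓞 F) F) →ₗ[AdeleRing (𝓞 F) F] (Fin n → AdeleRing (𝓞 F) F) →ₗ[AdeleRing (𝓞 F) F]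
      AdeleRing (𝓞 F) F := adelicForm F (Fin n) (1 : Matrix (Fin n) (Fin n) (AdeleRing (𝓞 F) F)) with hβ
  have hβ₁ : ∀ x y, β x y = x ⬝ᵥ y := fun x y => adelicForm_one_apply x y
  have hβc' : ∀ u, Continuous fun y : Fin n → AdeleRing (𝓞 F) F => β u y := fun u => by
    simp only [hβ₁]; exact continuous_const.dotProduct continuous_id
  letI tW : TopologicalSpace (AdelicSpace F V) := adelicSpaceTopology F V
  letI tH : TopologicalSpace (AdelicHeisenberg F E V Φ) := heisenbergTopology F E V Φ
  haveI : IsModuleTopology (AdeleRing (𝓞 F) F) (AdelicSpace F V) := ⟨rfl⟩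
  have hesymm : Continuous (e.symm : AdelicSpace F V → (Fin n → AdeleRing (𝓞 F) F) × (Fin n → AdeleRing (𝓞 F) F)) :=
    IsModuleTopology.continuous_of_linearMap e.symm.toLinearMap
  -- continuity of `toCoordHeisenberg e he` into `(𝐀ⁿ × 𝐀ⁿ) × 𝐀`
  have hpc : Continuous fun h : AdelicHeisenberg F E V Φ =>
      ((e.symm h.v, h.t + ⅟(2 : AdeleRing (𝓞 F) F) * β (e.symm h.v).1 (e.symm h.v).2) :
        ((Fin n → AdeleRing (𝓞 F) F) × (Fin n → AdeleRing (𝓞 F) F)) × AdeleRing (𝓞 F) F) := by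
    have hv : Continuous fun h : AdelicHeisenberg F E V Φ => h.v :=
      continuous_heisenberg_v (heisForm F E V Φ) (adelicSpaceTopology F V) inferInstance
    have ht : Continuous fun h : AdelicHeisenberg F E V Φ => h.t :=
      continuous_heisenberg_t (heisForm F E V Φ) (adelicSpaceTopology F V) inferInstance
    have hw : Continuous fun h : AdelicHeisenberg F E V Φ => e.symm h.v := hesymm.comp hv
    have hd : Continuous fun c : (Fin n → AdeleRing (𝓞 F) F) × (Fin n → AdeleRing (𝓞 F) F) => β c.1 c.2 := by
      simp only [hβ₁]; exact continuous_fst.dotProduct continuous_snd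
    exact hw.prodMk (ht.add (continuous_const.mul (hd.comp hw)))
  have hc := SchrodingerHaar.continuous_rep_mk β ψ hψc hβc ν hβc' f
  have e1 : (fun h : AdelicHeisenberg F E V Φ =>
      ((SchrodingerHaar.rep β ψ hψc hβc ν).comp (toCoordHeisenberg e he)) h f) =
        (fun q : ((Fin n → AdeleRing (𝓞 F) F) × (Fin n → AdeleRing (𝓞 F) F)) × AdeleRing (𝓞 F) F =>
          SchrodingerHaar.rep β ψ hψc hβc ν ⟨q.1, q.2⟩ f) ∘
        fun h : AdelicHeisenberg F E V Φ =>
          ((e.symm h.v, h.t + ⅟(2 : AdeleRing (𝓞 F) F) * β (e.symm h.v).1 (e.symm h.v).2) :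
            ((Fin n → AdeleRing (𝓞 F) F) × (Fin n → AdeleRing (𝓞 F) F)) × AdeleRing (𝓞 F) F) := by
    funext h
    rfl
  rw [e1]
  exact hc.comp hpc

/-- **irreducibility**: for `ψ` a non-trivial continuous character of `𝐀/F` (`IsGlobalAddChar`), the frame model has NO
closed invariant subspace other than `⊥` and `⊤` (binder `_hρi` of `Prop311AsPrinted`): `Weil1964.adelicSchrodingerL2_irreducible_one`
read through the surjection `toCoordHeisenberg e he`. [cite: GelbartRogawski1991, §3.1 p. 454 L19–21; Weil1964, Chap. I n° 11] -/
theorem irreducible_rep_comp_toCoordHeisenberg (hψ : IsGlobalAddChar F ψ)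
    (K : Submodule ℂ (Lp ℂ 2 ν)) (hKc : IsClosed (K : Set (Lp ℂ 2 ν)))
    (hK : ∀ (h : AdelicHeisenberg F E V Φ), ∀ f ∈ K,
      ((SchrodingerHaar.rep (adelicForm F (Fin n) (1 : Matrix (Fin n) (Fin n) (AdeleRing (𝓞 F) F))) ψ hψc hβc ν).comp
        (toCoordHeisenberg e he)) h f ∈ K) :
    K = ⊥ ∨ K = ⊤ := by
  classical
  refine adelicSchrodingerL2_irreducible_one F (Fin n) ψ hψ ν K hKc fun g f hf => ?_
  obtain ⟨h, rfl⟩ := toCoordHeisenberg_surjective e he g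
  exact hK h f hf

/-! ## §2 The frame model over the character of record `ψ_F`, with the inputs of the unitary leg -/

omit [BorelSpace (AdeleRing (𝓞 F) F)] in
/-- `L²(𝐀_Fⁿ, ν)` of an additive Haar measure is non-trivial (the `[Nontrivial S]` of `Prop311RhoPsiUnique` /
`Prop311ModelIndependence`). [cite: GelbartRogawski1991, §3.1 p. 454 L19–21] -/
theorem nontrivial_L2_adele [BorelSpace (AdeleRing (𝓞 F) F)] : Nontrivial (Lp ℂ 2 ν) := by
  haveI : BorelSpace (Fin n → AdeleRing (𝓞 F) F) := Pi.borelSpace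
  exact nontrivial_Lp_of_isAddHaarMeasure ν

/-- **density of `[·] : 𝒮(𝐀_Fⁿ) → L²(𝐀_Fⁿ, ν)`** — the input `hd` of `Weil1964.adelicMpCont.unitaryLegL2` — from the GR-lane
density theorem `Weil1964.dense_piSchwartzBruhat`. [cite: Weil1964, Chap. I n° 11] -/
theorem denseRange_schwartzBruhatToL2 : DenseRange (schwartzBruhatToL2 F (Fin n) ν) := by
  classical
  exact denseRange_schwartzBruhatToL2_of_dense ν (dense_piSchwartzBruhat F (Fin n) ν)

/-- **THE FRAME MODEL INHABITS THE PRINTED BINDERS.**  For every adelic Darboux frame `(e, he)` of `W_𝐀` and every additive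
Haar measure `ν` on `𝐀_Fⁿ`, the representation `ρ := ρ₁ ∘ toCoordHeisenberg e he` of `H_𝐀(W)` on `S = L²(𝐀_Fⁿ, ν)`,
`ρ₁ = SchrodingerHaar.rep (adelicForm F (Fin n) 1) ψ_F … ν` the `L²` completion of Weil's smooth Schrödinger model over the
character of record `ψ_F = adeleAddChar F`, satisfies the binders `_hρu _hρc _hρi _hρz` of `Prop311AsPrinted` at `ψ = ψ_F`;
moreover `S` is non-trivial and the classes of `𝒮(𝐀_Fⁿ)` are dense in it.  Together with `rep_comp_toCoordHeisenberg_apply`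
(`hρ` by `rfl`) these are the `ρ / ρ₁ / hρ` inputs of `legOfFrame` and `prop311_CM_of_boundedLeg` for the unitary leg
`Weil1964.adelicMpCont.unitaryLegL2 ν 1 hψc hβc hd hall`. [cite: GelbartRogawski1991, §3.1 p. 454 L17–24; Weil1964, Chap. I n° 11–13] -/
theorem rhoL2Frame_printed_binders
    (hψc : Continuous (adeleAddChar F : AdeleRing (𝓞 F) F → Circle)) :
    (∀ (h : AdelicHeisenberg F E V Φ) (f : Lp ℂ 2 ν),
        ‖((SchrodingerHaar.rep (adelicForm F (Fin n) (1 : Matrix (Fin n) (Fin n) (AdeleRing (𝓞 F) F))) (adeleAddChar F)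
          hψc hβc ν).comp (toCoordHeisenberg e he)) h f‖ = ‖f‖) ∧
      (∀ f : Lp ℂ 2 ν, @Continuous _ _ (heisenbergTopology F E V Φ) _ fun h : AdelicHeisenberg F E V Φ =>
        ((SchrodingerHaar.rep (adelicForm F (Fin n) (1 : Matrix (Fin n) (Fin n) (AdeleRing (𝓞 F) F))) (adeleAddChar F)
          hψc hβc ν).comp (toCoordHeisenberg e he)) h f) ∧
      (∀ K : Submodule ℂ (Lp ℂ 2 ν), IsClosed (K : Set (Lp ℂ 2 ν)) →
        (∀ (h : AdelicHeisenberg F E V Φ), ∀ f ∈ K,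
          ((SchrodingerHaar.rep (adelicForm F (Fin n) (1 : Matrix (Fin n) (Fin n) (AdeleRing (𝓞 F) F))) (adeleAddChar F)
            hψc hβc ν).comp (toCoordHeisenberg e he)) h f ∈ K) → K = ⊥ ∨ K = ⊤) ∧
      (∀ (t : AdeleRing (𝓞 F) F) (f : Lp ℂ 2 ν),
        ((SchrodingerHaar.rep (adelicForm F (Fin n) (1 : Matrix (Fin n) (Fin n) (AdeleRing (𝓞 F) F))) (adeleAddChar F)
            hψc hβc ν).comp (toCoordHeisenberg e he)) (Heisenberg.ofCenter (heisForm F E V Φ) (Multiplicative.ofAdd t)) f =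
          ((adeleAddChar F t : Circle) : ℂ) • f) ∧
      Nontrivial (Lp ℂ 2 ν) ∧ DenseRange (schwartzBruhatToL2 F (Fin n) ν) :=
  ⟨norm_rep_comp_toCoordHeisenberg e he (adeleAddChar F) hψc hβc ν,
    continuous_rep_comp_toCoordHeisenberg e he (adeleAddChar F) hψc hβc ν,
    irreducible_rep_comp_toCoordHeisenberg e he (adeleAddChar F) hψc hβc ν (isGlobalAddChar_adeleAddChar F),
    rep_comp_toCoordHeisenberg_ofCenter e he (adeleAddChar F) hψc hβc ν,
    nontrivial_L2_adele ν, denseRange_schwartzBruhatToL2 ν⟩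

end Prop311

end Literature.NumberTheory.GelbartRogawski1991

end
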